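/-
Copyright: lead seat `ym-line-sll-p1` (prover-ym-line-sll-p1-g0-0), route `SoftLoopLongLag`, crux `ColdBoxSoftLoopLagFloor`
(stmt-QuantumFields-24180; stub E1b `stub_innerDatumCovStabilityG` of `Cruxes/ColdBoxSoftLoopLagFloor/Lines/birth.lean` v7).
-/
import Summits.QuantumFields.YangMills.Theorems.SoftLoopLongLagLagFormPolarization

/-!
# The Dirichlet lag form with two weight functions: `B_D(a, b) ≥ −(C/4)·#cube²·‖b−a‖_∞² − (K·R⁴/H⁴)·Σ|a|·Σ|b|` near the centre
# (route `SoftLoopLongLag`, G-free; the drift price of stub E1b in the cold-wall box)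

WHAT.  `sum_sum_mul_mul_dirInductance_lag_ge_of_abs_sub_le`: for `H ≥ 32`, `T ≥ R`, any centre `c`, weights `a, b` on the time-zero cube with `|b − a| ≤ A`, and
all spanning surfaces `S(x+c)`, `S(x'+c+Te₀)` based within `H/8` of `boxCentre H`,
`Σ_{x,x'} a_x b_{x'} M_D(S(x+c), S(x'+c+Te₀)) ≥ −(C/4)·#cube_R²·A² − (K·R⁴/H⁴)·(Σ|a_x|)(Σ|b_x|)`,
`M_D` = the Dirichlet mutual inductance (double sum of `boxDirProjKernel H`).  Ingredients: the free drift price `sum_sum_mul_mul_mutualInductance_lag_ge_of_abs_sub_le`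
(symmetry + reflection positivity + `Σ|M| = O(#cube²)`), stationarity `mutualInductance_shift`, and ym-line-sll-p4's Dirichlet-vs-free comparison
`exists_abs_dirInductance_sub_mutualInductance_le`.  The one-weight case `a = b` is `SoftLoopLongLagDirichletLagPositivity`.

WHY.  With `a = Φ̄_c` (background flux at time `0`), `b = Φ̄_c^{(T)}` (at time `T = R`), `A ≍ R³s/H`, `|Φ̄| ≍ R²s` this is the `−C'·R¹²s²/H²` price of the LINEAR
background term of E1b (times `β`: `C·R¹²β^κ/H²`), plus the wall correction `K R⁴/H⁴·(#cube·R²s)² ≍ R¹⁴s²/H⁴ ≪ R¹²s²/H²`.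

HONEST LABEL.  Free-field bookkeeping for a RECORD-label rung line (R2xi-G, leaf `WeakCouplingRates.XiPow` = an UPPER bound on the lattice mass gap,
all compact simple `G`); NOT the Clay mass gap; no summit statement is touched.
-/

set_option autoImplicit false

noncomputable section

open Finset
open Literature.Probability.LatticeModels (Site)
open Literature.MathematicalPhysics.QuantumLattice (ZdPlaquette)
open Literature.MathematicalPhysics.QuantumFieldTheory
open Summit.QuantumFields.YangMills.Theorems.WeakCouplingRates

namespace Summit.QuantumFields.YangMills.Theorems.SoftLoopLongLag

/-- **Two-weight Dirichlet lag form, lower bound** (drift price + wall correction). -/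
theorem sum_sum_mul_mul_dirInductance_lag_ge_of_abs_sub_le :
    ∃ C K : ℝ, 0 ≤ C ∧ 0 ≤ K ∧ ∀ (H : ℕ), (32 : ℝ) ≤ H → ∀ (R T : ℕ), R ≤ T → ∀ (c : Site 4) (a b : Site 4 → ℝ) (A : ℝ),
      (∀ x ∈ timeZeroCube R, |b x - a x| ≤ A) →
      (∀ x ∈ timeZeroCube R, ∀ p ∈ rectSurface (x + c) R R, ‖p.1 - boxCentre H‖ ≤ (H : ℝ) / 8) →
      (∀ x' ∈ timeZeroCube R, ∀ q ∈ rectSurface (x' + c + Pi.single 0 (T : ℤ)) R R, ‖q.1 - boxCentre H‖ ≤ (H : ℝ) / 8) →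
      -(C / 4 * ((timeZeroCube R).card : ℝ) ^ 2 * A ^ 2) -
          K * (R : ℝ) ^ 4 / (H : ℝ) ^ 4 * ((∑ x ∈ timeZeroCube R, |a x|) * (∑ x ∈ timeZeroCube R, |b x|)) ≤
        ∑ x ∈ timeZeroCube R, ∑ x' ∈ timeZeroCube R, a x * b x' *
          ∑ p ∈ rectSurface (x + c) R R, ∑ q ∈ rectSurface (x' + c + Pi.single 0 (T : ℤ)) R R,
            boxDirProjKernel H ((p.1, p.2.1.1, p.2.1.2) : Plaq 4) ((q.1, q.2.1.1, q.2.1.2) : Plaq 4) := by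
  obtain ⟨C, hC, hfree⟩ := sum_sum_mul_mul_mutualInductance_lag_ge_of_abs_sub_le
  obtain ⟨K, hK0, hK⟩ := exists_abs_dirInductance_sub_mutualInductance_le
  refine ⟨C, K, hC, hK0, fun H hH R T hRT c a b A hab hS hS' => ?_⟩
  set E : ℝ := K * (R : ℝ) ^ 4 / (H : ℝ) ^ 4 with hE
  have hE0 : 0 ≤ E := by rw [hE]; positivity
  -- a purely real step: `|D − M| ≤ E ⇒ u v M − |u||v| E ≤ u v D`
  have key : ∀ {D M u v : ℝ}, |D - M| ≤ E → u * v * M - |u| * |v| * E ≤ u * v * D := by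
    intro D M u v h
    have hprod : |u * v * (D - M)| ≤ |u| * |v| * E := by
      rw [abs_mul, abs_mul]; exact mul_le_mul_of_nonneg_left h (by positivity)
    have hneg := neg_abs_le (u * v * (D - M))
    have e : u * v * (D - M) = u * v * D - u * v * M := by ring
    linarith
  have hshift : ∀ x x' : Site 4, mutualInductance (x + c) (x' + c + Pi.single 0 (T : ℤ)) R =
      mutualInductance x (x' + Pi.single 0 (T : ℤ)) R := fun x x' => by
    rw [add_right_comm x' c]
    exact mutualInductance_shift x _ c R
  have hlow : ∑ x ∈ timeZeroCube R, ∑ x' ∈ timeZeroCube R,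
      (a x * b x' * mutualInductance x (x' + Pi.single 0 (T : ℤ)) R - |a x| * |b x'| * E) ≤
      ∑ x ∈ timeZeroCube R, ∑ x' ∈ timeZeroCube R, a x * b x' *
          ∑ p ∈ rectSurface (x + c) R R, ∑ q ∈ rectSurface (x' + c + Pi.single 0 (T : ℤ)) R R,
            boxDirProjKernel H ((p.1, p.2.1.1, p.2.1.2) : Plaq 4) ((q.1, q.2.1.1, q.2.1.2) : Plaq 4) := by
    refine Finset.sum_le_sum fun x hx => Finset.sum_le_sum fun x' hx' => ?_
    have h := hK H hH _ _ R (hS x hx) (hS' x' hx')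
    rw [hshift] at h
    exact key h
  refine le_trans ?_ hlow
  simp only [Finset.sum_sub_distrib]
  have hB := hfree R T hRT a b A hab
  have habs : ∑ x ∈ timeZeroCube R, ∑ x' ∈ timeZeroCube R, |a x| * |b x'| * E =
      E * ((∑ x ∈ timeZeroCube R, |a x|) * (∑ x ∈ timeZeroCube R, |b x|)) := by
    rw [Finset.sum_mul_sum, Finset.mul_sum]
    refine Finset.sum_congr rfl fun x _ => ?_
    rw [Finset.mul_sum]
    exact Finset.sum_congr rfl fun x' _ => by ring
  rw [habs]
  linarith

end Summit.QuantumFields.YangMills.Theorems.SoftLoopLongLag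

end
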